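import Literature.MathematicalPhysics.QuantumFieldTheory.Balaban1983to89.B9DirSupAtPins
import Literature.MathematicalPhysics.QuantumFieldTheory.Balaban1983to89.B9RWSums344InputPair
import Literature.MathematicalPhysics.QuantumFieldTheory.Balaban1983to89.B9CoReadingCoordsHolderS

/-!
# `Balaban1983to89.B9DirSupHolderAtPins` — THE HÖLDER-PROBE DIRECTION-TRANSFER SCHEMAS `DirSupHolder37` ∕ `DirSupHolder310` HOLD AT THE PINS: n06-d's probe map
# `probeK` reads ONE direction slice of its argument (the slot of the probe), so the slice relabelling of `B9DirSupAtPins` passes through the probes — a probe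
# majorant of `Φ_β ∘ ∇_U ∘ T` is a probe majorant of every `Φ_β ∘ ∇_{U,ν} ∘ T` for slice-constant `T` (def-Y's `GcoS ∕ GcoK`), every configuration

T. Bałaban, *Propagators for lattice gauge theories in a background field*, Commun. Math. Phys. **99** (1985) 389–434
[`Balaban1985BackgroundPropagators`, "B9"]; [4] = T. Bałaban, *Propagators and renormalization transformations for lattice gauge
theories. II*, Commun. Math. Phys. **96** (1984) 223–250 [`Balaban1984PropagatorsII`].

statement-level skeleton of published theorems with citation tags; proofs where landed; nothing here is a claim about the Yang–Mills
mass gap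

THE PRINTED LOCI.  [B9] (3.39)–(3.40) p. 397 (the sup and Hölder norms of vector-valued lattice functions run over the direction index; the covariant
quotient `|U(Γ_{x,x′})A(x′) − A(x)| ∕ |x − x′|^α`), (3.43) p. 398 (`‖ζ∇_UG λ‖_β`), (3.3)–(3.8) pp. 390–392; [4] (2.51) p. 232.

THE POINT (cell `pub-ymgap`, node N06; width seat w5, CLAIM-3 sequel; dag-n06-d's BRIEF «DirSup ∕ DirTranspose(∕DirSupHolder) 37 ∕ 310 at the pins», node00-def-Y's
«one declarer of the relabelling»).  The N06 certificate (ed. 28) displays in `h36H` ∕ `h36HA` the conjuncts `DirSupHolder37 (𝔬 x) (𝔡 x) (𝔭 x) 1 (H x) U` and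
`DirSupHolder310 (𝔬A x) (𝔡A x) (𝔭A x) 1 (H x) U` (n06-k, `B9RWSums344InputPair`): the Y-probe majorant of `Φ^Y_β ∘ ∇_U ∘ G` gives the X-probe majorant of every
`Φ^X_β ∘ ∇_{U,ν} ∘ G`.  At the pins `Φ^X = Φ^Y = probeK b (U(Γ_{·,·})) w w₀` (`holderProbesS ∕ holderProbesK`) and every probe — pair, transported point, point — reads ONE
direction slice of the coordinate vector (`probeK_inl ∕ _inr_inl ∕ _inr_inr`), its anchors `blkPK` are slot-blind; so the predecessor's relabelling passes through:
* §1 `probeK_eq_of_slice_eq` (two vectors with equal `λ`- resp. `μ`-slices have equal probes at the slots `λ` resp. `μ`, same points and coordinates) and ★★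
  `hasMajorantHom_probe_constSlice_of_family` (`HasMajorantHom blk (blkPK sP) (probeK … ∘ₗ (r • coordOpK b F)) m → ∀ μ, HasMajorantHom blk (blkPK sP) (probeK … ∘ₗ (r •
  coordOpK b (fun _ => F μ))) m` for slot-blind `blk`);
* §2 ★★ `dirSupHolder37_of_pins` (pins `hblk ∕ hGp ∕ hD ∕ hDd` + `h𝔭 : 𝔭 = holderProbesS i b B cfg par sI'`-free form: any probe letters whose `ΦX = ΦY = probeK …` and
  `blkPX = blkPY = blkPK sP`) and ★★ `dirSupHolder310_of_pins`; §3 member forms `dirSupHolder37_pins ∕ dirSupHolder310_pins` with the certificate's pins `h𝔭 ∕ h𝔭A ∕ hblkS ∕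
  hGpS ∕ hDS ∕ h𝔡d ∕ hblkA ∕ hGcoA ∕ hDcoA ∕ h𝔡Ad` VERBATIM, every member, every `U`.

HONEST SCOPE.  Relabelling algebra over n06-d's `coordOpK ∕ probeK`; no estimate of [B9] asserted (the probe majorants `m` are the schemas' own hypotheses); COUNT-NEUTRAL;
N06 is NOT discharged; one finite lattice at a time; nothing continuum, nothing about the mass gap ∕ Clay.  Cell `pub-ymgap` (HUMAN RULING D-0062 ∕ D-0154),
Track A node N06 [B9], width seat `pub-ymgap-dag-n06-w5` (g0), 2026-08-28.
-/

noncomputable section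

namespace Literature.MathematicalPhysics.QuantumFieldTheory.Balaban1983to89.B9DirSupHolderAtPins

open B6KLevelCensusIndexV1 (KIdx)
open B6RandomWalk (HasMajorant BlockSupp)
open B6RandomWalkHom (HasMajorantHom)
open B9Eq39Adjoint (R)
open B9Thm34Ext (toB6)
open B9Thm37Whole (Ops)
open B9Thm310Whole (Ops310)
open B9RWSums346SecondDiffGp (DirOps37)
open B9RWSums346SecondDiff (DirOps310)
open B9RWSums343Holder (HolderProbes)
open B9RWSums344InputPair (DirSupHolder37 DirSupHolder310)
open B9Thm39ReadingCoords (cR39)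
open B9GeoNormsKLevelV1 (geo9K)
open B9CoReadingCoords (assembleK coordOpK coordOpK_apply coordOpK_comp XBK blkBK GcoK DcoK cdBₗ)
open B9CoReadingCoordsS (XSK blkSK sIK GcoS DcoS)
open B9CoReadingCoordsHolder (PK blkPK probeK probeK_inl probeK_inr_inl probeK_inr_inr holderProbesK)
open B9CoReadingCoordsHolderS (holderProbesS)
open B9Ineq349SiteComposite (cdSL)
open B9DirSupAtPins (assembleK_swapSlot blockSupp_swapSlot smul_coordOpK_comp_smul_coordOpK)
open Node00
open scoped Matrix

variable {d ℓ : ℕ} {hd : 1 ≤ d + 1} {hL : Odd (ℓ + 1) ∧ 1 < ℓ + 1} {b₀ b₁ : ℝ}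

/-! ## §1 The probes read one slice: relabelling passes through `probeK` -/

section Relabel

variable {𝔸 : Type} [NormedRing 𝔸] [NormedAlgebra ℂ 𝔸] [FiniteDimensional ℝ 𝔸]
variable {κ : Type} [Fintype κ]
variable {S D : Type} [DecidableEq D] (b : Module.Basis κ ℝ 𝔸)

omit [DecidableEq D] [FiniteDimensional ℝ 𝔸] in
/-- two coordinate vectors whose `lam`- resp. `mu`-slices agree pointwise have the same re-assembled slices. [cite: Balaban1985BackgroundPropagators, (3.39) p.397, dictionary] -/
theorem assembleK_eq_of_slice_eq {V V' : S × D × κ × κ → ℝ} {lam mu : D} (hV : ∀ z a c', V (z, lam, a, c') = V' (z, mu, a, c')) (c' : κ) :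
    assembleK b lam c' V = assembleK b mu c' V' := by
  funext z
  show (∑ a, V (z, lam, a, c') • b a) = ∑ a, V' (z, mu, a, c') • b a
  exact Finset.sum_congr rfl fun a _ => by rw [hV z a c']

omit [DecidableEq D] [FiniteDimensional ℝ 𝔸] in
/-- **A PROBE READS ONE SLICE**: if the `lam`-slice of `V` is the `mu`-slice of `V′`, then every probe of `V` at the slot `lam` equals the probe of `V′` with the same points
and coordinates at the slot `mu` — pair, transported point and point probes alike (`probeK_inl ∕ _inr_inl ∕ _inr_inr`).
[cite: Balaban1985BackgroundPropagators, (3.39)–(3.40) p.397, dictionary] -/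
theorem probeK_eq_of_slice_eq (g : S → S → 𝔸ˣ) (w : S → S → ℝ) (w₀ : S → ℝ) {V V' : S × D × κ × κ → ℝ} {lam mu : D}
    (hV : ∀ z a c', V (z, lam, a, c') = V' (z, mu, a, c')) (xx : S × S) (x : S) (c c' : κ) :
    probeK b g w w₀ V (Sum.inl (xx, lam, c, c')) = probeK b g w w₀ V' (Sum.inl (xx, mu, c, c')) ∧
      probeK b g w w₀ V (Sum.inr (Sum.inl (xx, lam, c, c'))) = probeK b g w w₀ V' (Sum.inr (Sum.inl (xx, mu, c, c'))) ∧
        probeK b g w w₀ V (Sum.inr (Sum.inr (x, lam, c, c'))) = probeK b g w w₀ V' (Sum.inr (Sum.inr (x, mu, c, c'))) := by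
  refine ⟨?_, ?_, ?_⟩
  · rw [probeK_inl, probeK_inl]
    simp only [assembleK_eq_of_slice_eq b hV c']
  · rw [probeK_inr_inl, probeK_inr_inl]
    simp only [assembleK_eq_of_slice_eq b hV c']
  · rw [probeK_inr_inr, probeK_inr_inr]
    simp only [hV x c c']

omit [FiniteDimensional ℝ 𝔸] in
/-- ★★ **SLICE RELABELLING THROUGH THE PROBES**: over a carrier blocked through its first coordinate only and probe anchors `blkPK sP` (slot-blind), a probe
majorant `m` of `Φ ∘ (r • coordOpK b F)` (the direction family slice by slice, `Φ = probeK b g w w₀`) is, for every `μ`, a probe majorant of `Φ ∘ (r • coordOpK b (fun _ =>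
F μ))`: the probe at slot `λ` of the latter on `f` is the probe at slot `μ` of the former on the input with the `μ`- and `λ`-slices swapped.
[cite: Balaban1985BackgroundPropagators, (3.39)–(3.40) p.397 + (3.43) p.398; Balaban1984PropagatorsII, (2.51) p.232] -/
theorem hasMajorantHom_probe_constSlice_of_family {G : B6.Geometry} (s sP : S → G.Site) (g : S → S → 𝔸ˣ) (w : S → S → ℝ) (w₀ : S → ℝ)
    (F : D → (S → 𝔸) →ₗ[ℝ] (S → 𝔸)) (r : ℝ) {m : G.Site → G.Site → ℝ}
    (h : HasMajorantHom (g := G) (fun p : S × D × κ × κ => s p.1) (blkPK (D := D) (κ := κ) sP)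
      (probeK b g w w₀ ∘ₗ (r • coordOpK b F)) m) (μ : D) :
    HasMajorantHom (g := G) (fun p : S × D × κ × κ => s p.1) (blkPK (D := D) (κ := κ) sP)
      (probeK b g w w₀ ∘ₗ (r • coordOpK b (fun _ : D => F μ))) m := by
  intro y' f B hf q
  -- the slot of the probe and the swapped input
  have key : ∀ lam : D,
      let f' : S × D × κ × κ → ℝ := fun q : S × D × κ × κ => f (q.1, Equiv.swap μ lam q.2.1, q.2.2)
      (∀ z a c', (r • coordOpK b (fun _ : D => F μ)) f (z, lam, a, c') = (r • coordOpK b F) f' (z, μ, a, c')) ∧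
        BlockSupp (fun p : S × D × κ × κ => s p.1) f' y' B := fun lam =>
    ⟨fun z a c' => by
      simp only [LinearMap.smul_apply, Pi.smul_apply, smul_eq_mul, coordOpK_apply, assembleK_swapSlot],
     blockSupp_swapSlot s μ lam hf⟩
  rcases q with ⟨xx, lam, c, c'⟩ | ⟨xx, lam, c, c'⟩ | ⟨x, lam, c, c'⟩
  · obtain ⟨hV, hf'⟩ := key lam
    have hb := h y' _ B hf' (Sum.inl (xx, μ, c, c'))
    rw [LinearMap.comp_apply] at hb ⊢
    rw [(probeK_eq_of_slice_eq b g w w₀ hV xx xx.1 c c').1]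
    exact hb
  · obtain ⟨hV, hf'⟩ := key lam
    have hb := h y' _ B hf' (Sum.inr (Sum.inl (xx, μ, c, c')))
    rw [LinearMap.comp_apply] at hb ⊢
    rw [(probeK_eq_of_slice_eq b g w w₀ hV xx xx.1 c c').2.1]
    exact hb
  · obtain ⟨hV, hf'⟩ := key lam
    have hb := h y' _ B hf' (Sum.inr (Sum.inr (x, μ, c, c')))
    rw [LinearMap.comp_apply] at hb ⊢
    rw [(probeK_eq_of_slice_eq b g w w₀ hV (x, x) x c c').2.2]
    exact hb

end Relabel

/-! ## §2 The Hölder transfer schemas at the pins, every configuration -/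

section Pins

variable {𝔸 : Type} [NormedRing 𝔸] [NormedAlgebra ℂ 𝔸] [CompleteSpace 𝔸] [FiniteDimensional ℝ 𝔸]
variable {κ : Type} [Fintype κ]
variable (i : KIdx d ℓ hd hL b₀ b₁) (b : Module.Basis κ ℝ 𝔸) (B : B9.Backgrounds) (cfg : B.Cfg → CfgY 𝔸 i)
variable {ι : Type} [Fintype (geo9K i).Site]

/-- ★★ **`DirSupHolder37` AT THE SITE-SECTOR PINS, EVERY CONFIGURATION** (the displayed conjunct of `h36H`): for probe letters with `ΦX = ΦY = probeK b g w w₀` on one probe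
lattice anchored by the slot-blind `blkPK sP` (def-Y ∕ n06-d's `holderProbesS`: `g = U(Γ_{·,·})`, `w = wS β`, `w₀ = 1`), block map `fun p => sI p.1` (`blkSK sI`), `G′ = GcoS`
(slice-constant) and `∇_U ∕ ∇_{U,ν}` pinned to `DcoS` ∕ `η⁻¹ • coordOpK b (fun _ => ∇_{U,ν})`.
[cite: Balaban1985BackgroundPropagators, (3.43) p.398 + (3.39)–(3.40) p.397 + (3.42) p.397; Balaban1984PropagatorsII, (2.51) p.232] -/
theorem dirSupHolder37_of_pins (O : SiteOpY 𝔸 i) (𝔬 : Ops (geo9K i) B (XSK κ i) (XSK κ i) ι)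
    (𝔡 : DirOps37 𝔬 (Fin (d + 1)))
    (𝔭 : HolderProbes (geo9K i) B (XSK κ i) (XSK κ i) (PK (SiteY i) (Fin (d + 1)) κ) (PK (SiteY i) (Fin (d + 1)) κ))
    {sI sP : SiteY i → IBondY i} (g : B.Cfg → SiteY i → SiteY i → 𝔸ˣ) (w : ℝ → SiteY i → SiteY i → ℝ) (w₀ : ℝ → SiteY i → ℝ)
    (hblk : 𝔬.blk = blkSK i sI) {U₁ : B.Cfg}
    (hΦX : ∀ β, 𝔭.ΦX U₁ β = probeK b (g U₁) (w β) (w₀ β)) (hΦY : ∀ β, 𝔭.ΦY U₁ β = probeK b (g U₁) (w β) (w₀ β))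
    (hPX : 𝔭.blkPX = blkPK sP) (hPY : 𝔭.blkPY = blkPK sP)
    (hGp : 𝔬.Gp U₁ = GcoS i b B cfg O U₁) (hD : 𝔬.D U₁ = DcoS i b B cfg U₁)
    (hDd : 𝔡.Dd U₁ = fun μ => (etaS i)⁻¹ • coordOpK b (fun _ : Fin (d + 1) => (cdSL i (cfg U₁) μ).restrictScalars ℝ))
    {R : ℝ} {H : Prop} : DirSupHolder37 𝔬 𝔡 𝔭 R H U₁ := by
  refine ⟨fun β m hm ν => ?_⟩
  rw [hblk, hPY, hΦY, hD, hGp, LinearMap.comp_assoc] at hm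
  rw [hblk, hPX, hΦX, hDd, hGp, LinearMap.comp_assoc]
  change HasMajorantHom (g := toB6 (geo9K i) R H) (fun p : XSK κ i => sI p.1) (blkPK sP)
    (probeK b (g U₁) (w β) (w₀ β) ∘ₗ (((etaS i)⁻¹ • coordOpK b (fun _ : Fin (d + 1) => (cdSL i (cfg U₁) ν).restrictScalars ℝ)) ∘ₗ
      ((etaS i ^ 2 * cR39 b) • coordOpK b (fun _ : Fin (d + 1) => (O (cfg U₁)).restrictScalars ℝ)))) m
  change HasMajorantHom (g := toB6 (geo9K i) R H) (fun p : XSK κ i => sI p.1) (blkPK sP)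
    (probeK b (g U₁) (w β) (w₀ β) ∘ₗ (((etaS i)⁻¹ • coordOpK b (fun μ : Fin (d + 1) => (cdSL i (cfg U₁) μ).restrictScalars ℝ)) ∘ₗ
      ((etaS i ^ 2 * cR39 b) • coordOpK b (fun _ : Fin (d + 1) => (O (cfg U₁)).restrictScalars ℝ)))) m at hm
  rw [smul_coordOpK_comp_smul_coordOpK] at hm ⊢
  exact hasMajorantHom_probe_constSlice_of_family b (G := toB6 (geo9K i) R H) sI sP (g U₁) (w β) (w₀ β)
    (fun μ : Fin (d + 1) => (cdSL i (cfg U₁) μ).restrictScalars ℝ ∘ₗ (O (cfg U₁)).restrictScalars ℝ) _ hm ν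

/-- ★★ **`DirSupHolder310` AT THE BOND-SECTOR PINS, EVERY CONFIGURATION** (the displayed conjunct of `h36HA`; def-Y ∕ n06-d's `holderProbesK`: `g = U(Γ_{·,·})`, `w = wK β`,
`w₀ = w₀K β`), block map `blkBK bI`, `G = GcoK` (slice-constant), `∇_U ∕ ∇_{U,ν}` pinned to `DcoK` ∕ `coordOpK b (fun _ => ∇_{U,ν})`.
[cite: Balaban1985BackgroundPropagators, (3.43) p.398 + (3.39)–(3.40) p.397 + Thm 3.10 p.416; Balaban1984PropagatorsII, (2.51) p.232] -/
theorem dirSupHolder310_of_pins {A : Type} (OA : BondOpY 𝔸 i)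
    (𝔬 : Ops310 (geo9K i) B (XBK κ i) (XBK κ i) ι A) (𝔡 : DirOps310 𝔬 (Fin (d + 1)))
    (𝔭 : HolderProbes (geo9K i) B (XBK κ i) (XBK κ i) (PK (FBondY i) (Fin (d + 1)) κ) (PK (FBondY i) (Fin (d + 1)) κ))
    {bI bP : FBondY i → IBondY i} (g : B.Cfg → FBondY i → FBondY i → 𝔸ˣ) (w : ℝ → FBondY i → FBondY i → ℝ) (w₀ : ℝ → FBondY i → ℝ)
    (hblk : 𝔬.blk = blkBK i bI) {U₁ : B.Cfg}
    (hΦX : ∀ β, 𝔭.ΦX U₁ β = probeK b (g U₁) (w β) (w₀ β)) (hΦY : ∀ β, 𝔭.ΦY U₁ β = probeK b (g U₁) (w β) (w₀ β))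
    (hPX : 𝔭.blkPX = blkPK bP) (hPY : 𝔭.blkPY = blkPK bP)
    (hG : 𝔬.G U₁ = GcoK i b B cfg OA U₁) (hD : 𝔬.D U₁ = DcoK i b B cfg U₁)
    (hDd : 𝔡.Dd U₁ = fun μ => coordOpK b (fun _ : Fin (d + 1) => cdBₗ i (cfg U₁) μ))
    {R : ℝ} {H : Prop} : DirSupHolder310 𝔬 𝔡 𝔭 R H U₁ := by
  refine ⟨fun β m hm ν => ?_⟩
  rw [hblk, hPY, hΦY, hD, hG, LinearMap.comp_assoc] at hm
  rw [hblk, hPX, hΦX, hDd, hG, LinearMap.comp_assoc]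
  change HasMajorantHom (g := toB6 (geo9K i) R H) (fun p : XBK κ i => bI p.1) (blkPK bP)
    (probeK b (g U₁) (w β) (w₀ β) ∘ₗ ((coordOpK b (fun _ : Fin (d + 1) => cdBₗ i (cfg U₁) ν)) ∘ₗ
      ((cR39 b) • coordOpK b (fun _ : Fin (d + 1) => (OA (cfg U₁)).restrictScalars ℝ)))) m
  change HasMajorantHom (g := toB6 (geo9K i) R H) (fun p : XBK κ i => bI p.1) (blkPK bP)
    (probeK b (g U₁) (w β) (w₀ β) ∘ₗ ((coordOpK b (fun μ : Fin (d + 1) => cdBₗ i (cfg U₁) μ)) ∘ₗ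
      ((cR39 b) • coordOpK b (fun _ : Fin (d + 1) => (OA (cfg U₁)).restrictScalars ℝ)))) m at hm
  rw [← one_smul ℝ (coordOpK b (fun _ : Fin (d + 1) => cdBₗ i (cfg U₁) ν)), smul_coordOpK_comp_smul_coordOpK]
  rw [← one_smul ℝ (coordOpK b (fun μ : Fin (d + 1) => cdBₗ i (cfg U₁) μ)), smul_coordOpK_comp_smul_coordOpK] at hm
  exact hasMajorantHom_probe_constSlice_of_family b (G := toB6 (geo9K i) R H) bI bP (g U₁) (w β) (w₀ β)
    (fun μ : Fin (d + 1) => cdBₗ i (cfg U₁) μ ∘ₗ (OA (cfg U₁)).restrictScalars ℝ) _ hm ν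

end Pins

/-! ## §3 At node00-def-Y's members, the certificate's pins verbatim -/

section Members

open scoped Matrix.Norms.L2Operator
open B7Prop2SpecialUnitary (specialUnitaryUnits)
open B9PinMembersKLevelV1 (MemberY geo9Y bg9Y)
open B9CoReadingCoordsTranspose (TrIdx trBasis)

variable {Mstar : ℕ} {N : ℕ}
variable [∀ x : MemberY d ℓ hd hL b₀ b₁ Mstar, Fintype (geo9Y x).Site]

/-- ★★ **`DirSupHolder37 (𝔬 x) (𝔡 x) (𝔭 x) R H U` AT THE CERTIFICATE'S PINS, EVERY MEMBER, EVERY `U`** (pins `h𝔭 ∕ hblkS ∕ hGpS ∕ hDS ∕ h𝔡d` verbatim; `Gp ∕ parS` = any site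
letter ∕ site transporter, e.g. `(lettersYOfRecordV4P …).Gp ∕ .parS`). [cite: Balaban1985BackgroundPropagators, (3.43) p.398 + (3.39)–(3.40) p.397; Balaban1984PropagatorsII, (2.51) p.232] -/
theorem dirSupHolder37_pins (x : MemberY d ℓ hd hL b₀ b₁ Mstar) {ι : Type}
    (𝔬 : Ops (geo9Y x) (bg9Y (Matrix (Fin N) (Fin N) ℂ) (specialUnitaryUnits (Fin N)) x) (XSK (TrIdx N) x.toKIdx) (XSK (TrIdx N) x.toKIdx) ι)
    (𝔡 : DirOps37 𝔬 (Fin (d + 1)))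
    (𝔭 : HolderProbes (geo9Y x) (bg9Y (Matrix (Fin N) (Fin N) ℂ) (specialUnitaryUnits (Fin N)) x) (XSK (TrIdx N) x.toKIdx) (XSK (TrIdx N) x.toKIdx)
      (PK (SiteY x.toKIdx) (Fin (d + 1)) (TrIdx N)) (PK (SiteY x.toKIdx) (Fin (d + 1)) (TrIdx N)))
    {bI : FBondY x.toKIdx → IBondY x.toKIdx} (Gp : SiteOpY (Matrix (Fin N) (Fin N) ℂ) x.toKIdx) (parS : SiteParY (Matrix (Fin N) (Fin N) ℂ) x.toKIdx)
    (h𝔭 : 𝔭 = holderProbesS x.toKIdx (trBasis N) (bg9Y (Matrix (Fin N) (Fin N) ℂ) (specialUnitaryUnits (Fin N)) x) (fun U => U) parS bI)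
    (hblkS : 𝔬.blk = blkSK x.toKIdx (sIK x.toKIdx bI)) {U : (bg9Y (Matrix (Fin N) (Fin N) ℂ) (specialUnitaryUnits (Fin N)) x).Cfg}
    (hGpS : 𝔬.Gp U = GcoS x.toKIdx (trBasis N) (bg9Y (Matrix (Fin N) (Fin N) ℂ) (specialUnitaryUnits (Fin N)) x) (fun U => U) Gp U)
    (hDS : 𝔬.D U = DcoS x.toKIdx (trBasis N) (bg9Y (Matrix (Fin N) (Fin N) ℂ) (specialUnitaryUnits (Fin N)) x) (fun U => U) U)
    (h𝔡d : 𝔡.Dd U = fun μ => (etaS x.toKIdx)⁻¹ • coordOpK (trBasis N) (fun _ : Fin (d + 1) => (cdSL x.toKIdx U μ).restrictScalars ℝ))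
    {R : ℝ} {H : Prop} : DirSupHolder37 𝔬 𝔡 𝔭 R H U := by
  letI : Fintype (geo9K x.toKIdx).Site := (inferInstance : Fintype (geo9Y x).Site)
  subst h𝔭
  exact dirSupHolder37_of_pins x.toKIdx (trBasis N) (bg9Y (Matrix (Fin N) (Fin N) ℂ) (specialUnitaryUnits (Fin N)) x) (fun U => U) Gp 𝔬 𝔡 _
    (fun U z z' => parS U z z') (fun β => B9CoReadingCoordsHolderS.wS x.toKIdx β) (fun _ _ => (1 : ℝ)) hblkS (fun β => rfl) (fun β => rfl) rfl rfl
    hGpS hDS h𝔡d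

/-- ★★ **`DirSupHolder310 (𝔬A x) (𝔡A x) (𝔭A x) R H U` AT THE CERTIFICATE'S PINS, EVERY MEMBER, EVERY `U`** (pins `h𝔭A ∕ hblkA ∕ hGcoA ∕ hDcoA ∕ h𝔡Ad` verbatim; `GA ∕ parB` = any bond
letter ∕ bond transporter, e.g. `(lettersYOfRecordV4P …).GA ∕ .parB`). [cite: Balaban1985BackgroundPropagators, (3.43) p.398 + (3.39)–(3.40) p.397 + Thm 3.10 p.416; Balaban1984PropagatorsII, (2.51) p.232] -/
theorem dirSupHolder310_pins (x : MemberY d ℓ hd hL b₀ b₁ Mstar) {ι A : Type}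
    (𝔬 : Ops310 (geo9Y x) (bg9Y (Matrix (Fin N) (Fin N) ℂ) (specialUnitaryUnits (Fin N)) x) (XBK (TrIdx N) x.toKIdx) (XBK (TrIdx N) x.toKIdx) ι A)
    (𝔡 : DirOps310 𝔬 (Fin (d + 1)))
    (𝔭 : HolderProbes (geo9Y x) (bg9Y (Matrix (Fin N) (Fin N) ℂ) (specialUnitaryUnits (Fin N)) x) (XBK (TrIdx N) x.toKIdx) (XBK (TrIdx N) x.toKIdx)
      (PK (FBondY x.toKIdx) (Fin (d + 1)) (TrIdx N)) (PK (FBondY x.toKIdx) (Fin (d + 1)) (TrIdx N)))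
    {bI : FBondY x.toKIdx → IBondY x.toKIdx} (GA : BondOpY (Matrix (Fin N) (Fin N) ℂ) x.toKIdx) (parB : BondParY (Matrix (Fin N) (Fin N) ℂ) x.toKIdx)
    (h𝔭A : 𝔭 = holderProbesK x.toKIdx (trBasis N) (bg9Y (Matrix (Fin N) (Fin N) ℂ) (specialUnitaryUnits (Fin N)) x) (fun U => U) parB bI)
    (hblkA : 𝔬.blk = blkBK x.toKIdx bI) {U : (bg9Y (Matrix (Fin N) (Fin N) ℂ) (specialUnitaryUnits (Fin N)) x).Cfg}
    (hGcoA : 𝔬.G U = GcoK x.toKIdx (trBasis N) (bg9Y (Matrix (Fin N) (Fin N) ℂ) (specialUnitaryUnits (Fin N)) x) (fun U => U) GA U)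
    (hDcoA : 𝔬.D U = DcoK x.toKIdx (trBasis N) (bg9Y (Matrix (Fin N) (Fin N) ℂ) (specialUnitaryUnits (Fin N)) x) (fun U => U) U)
    (h𝔡Ad : 𝔡.Dd U = fun μ => coordOpK (trBasis N) (fun _ : Fin (d + 1) => cdBₗ x.toKIdx U μ))
    {R : ℝ} {H : Prop} : DirSupHolder310 𝔬 𝔡 𝔭 R H U := by
  letI : Fintype (geo9K x.toKIdx).Site := (inferInstance : Fintype (geo9Y x).Site)
  subst h𝔭A
  exact dirSupHolder310_of_pins x.toKIdx (trBasis N) (bg9Y (Matrix (Fin N) (Fin N) ℂ) (specialUnitaryUnits (Fin N)) x) (fun U => U) GA 𝔬 𝔡 _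
    (fun U f f' => parB U f.src f'.src) (fun β => B9CoReadingCoordsHolder.wK x.toKIdx β) (fun β => B9CoReadingCoordsHolder.w₀K x.toKIdx β) hblkA
    (fun β => rfl) (fun β => rfl) rfl rfl hGcoA hDcoA h𝔡Ad

end Members

end Literature.MathematicalPhysics.QuantumFieldTheory.Balaban1983to89.B9DirSupHolderAtPins

end
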